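import Summits.AtomisticToContinuum.Crystallization.Theorems.ExcessDecayLiouvillePhononStabilityDefs
import Summits.AtomisticToContinuum.Crystallization.Theorems.ExcessDecayLiouvillePhononStabilityFarDefs
import Summits.AtomisticToContinuum.Crystallization.Theorems.ExcessDecayLiouvillePhononStabilityWindow
import Summits.AtomisticToContinuum.Crystallization.Theorems.ExcessDecayLiouvillePhononStabilityTail

/-!
# `PhononStability` (stmt-AtomisticToContinuum-9333), line `contragredient-window-collapse`: stub `stub_tailSum`

Reduction S9 of the reshaped line (`TailSum`, the ANALYTIC far-far constant): granted the packing count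
`LatticeCount` (a finite set of points of a shifted copy `latVec ℤ³ + y` of the period lattice inside the
ball of radius `ρ` has at most `(2ρ + 1)³` elements), for every `R ≥ 100` the lattice sum
`farTailConst R = Σ_{‖ζ⁰_c‖ > R} 18‖ζ⁰_c‖⁻⁸ · pathConst c` converges and is `≤ 40000/R³`.

* **Term bound.** For a class `c = (m, m', n)` with `ρ = ‖ζ⁰_c‖`, the coordinate formula
  `36ρ² = 9(2n₀ + n₁ + s)² + 3(3n₁ + s)² + 24(2n₂ + s)²` (`|s| ≤ 1`, Window file) gives
  `|2n₂ + s| ≤ (5/4)ρ`, `|3n₁ + s| ≤ (7/2)ρ`, `|2n₀ + n₁ + s| ≤ 2ρ`, hence `|n₂| ≤ (5/8)ρ + 1/2`,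
  `|n₁| ≤ (7/6)ρ + 1/3`, `|n₀| ≤ (19/12)ρ + 2/3`; so for `ρ ≥ 100`
  `pathConst c ≤ (4ρ + 3)((19/12)ρ + 5/3) ≤ (13/2)ρ²` and `farCoeff c · pathConst c ≤ 117ρ⁻⁶`.
* **Dyadic shells.** Fix a sublattice pair `(m, m')`: `ζ⁰_{(m,m',n)} = latVec n + (σ(m') − σ(m))·innerRef`.
  A class outside `classesR R` has `ρ > R`; its SHELL is the least `k` with `ρ ≤ 2^{k+1}R`, so that
  `2^k R < ρ ≤ 2^{k+1} R`.  By `LatticeCount` a finite set of classes of the pair in shell `k` has at most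
  `(2^{k+2}R + 1)³ ≤ (4.01 · 2^k R)³` elements, each contributing `≤ 117(2^k R)⁻⁶`; so shell `k`
  contributes `≤ 7600 · 8^{-k}/R³`, and `Σ_k 8^{-k} = 8/7` gives `≤ 8700/R³` per pair, i.e.
  `≤ 34800/R³ ≤ 40000/R³` for the four pairs.
* **Summation.** The summand is `≥ 0` and every finite partial sum is `≤ 40000/R³` (split the finite set by
  the pair and fibrewise by the shell); `summable_of_sum_le` and `Real.tsum_le_of_sum_le` conclude.

All `[folklore]`.
-/

noncomputable section

open scoped BigOperators Classical InnerProductSpace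
open Filter Set Function
open Literature.MathematicalPhysics.StatisticalMechanics
open Summit.AtomisticToContinuum.Crystallization.Theses.ExcessDecayLiouville
open Summit.AtomisticToContinuum.Crystallization.Theorems.PhononStabilityNegative
open Summit.AtomisticToContinuum.Crystallization.Theorems.PhononStabilityCWC

namespace Summit.AtomisticToContinuum.Crystallization.Theorems.PhononStabilityCWC.TailSumStub

/-! ## The term bound -/

/-- `|σ(m') − σ(m)| ≤ 1`; copy of the line's Basics lemma. [folklore] -/
private theorem abs_subSign_sub_le (m m' : Fin 2) : |subSign m' - subSign m| ≤ 1 := by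
  unfold subSign
  split_ifs <;> norm_num

/-- `pathConst c ≥ 0` (a product of two positive integers). [folklore] -/
theorem pathConst_nonneg (c : BondClass) : 0 ≤ pathConst c := by
  unfold pathConst
  positivity

/-- `farCoeff c ≥ 0`; copy of the line's Basics lemma. [folklore] -/
private theorem farCoeff_nonneg (c : BondClass) : 0 ≤ farCoeff c := by
  unfold farCoeff
  positivity

/-- **Coordinate bounds:** for `c = (m, m', n)` with `ρ = ‖ζ⁰_c‖`: `|n₂| ≤ (5/8)ρ + 1/2`,
`|n₁| ≤ (7/6)ρ + 1/3`, `|n₀| ≤ (19/12)ρ + 2/3` (from `36ρ² = 9(2n₀ + n₁ + s)² + 3(3n₁ + s)² + 24(2n₂ + s)²`,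
`|s| ≤ 1`, via `(2n₂ + s)² ≤ ((5/4)ρ)²`, `(3n₁ + s)² ≤ ((7/2)ρ)²`, `(2n₀ + n₁ + s)² ≤ (2ρ)²`). [folklore] -/
theorem abs_coord_le (m m' : Fin 2) (n : Fin 3 → ℤ) :
    |(n 2 : ℝ)| ≤ 5 / 8 * ‖bondVec 0 (m, m', n)‖ + 1 / 2 ∧
      |(n 1 : ℝ)| ≤ 7 / 6 * ‖bondVec 0 (m, m', n)‖ + 1 / 3 ∧
        |(n 0 : ℝ)| ≤ 19 / 12 * ‖bondVec 0 (m, m', n)‖ + 2 / 3 := by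
  have hq := WindowStub.norm_sq_bondVec_zero m m' n
  have hs := abs_le.mp (abs_subSign_sub_le m m')
  set s : ℝ := subSign m' - subSign m
  set ρ : ℝ := ‖bondVec 0 (m, m', n)‖
  have hρ : 0 ≤ ρ := norm_nonneg _
  have hρ2 := sq_nonneg ρ
  have hX := sq_nonneg (2 * (n 0 : ℝ) + n 1 + s)
  have hY := sq_nonneg (3 * (n 1 : ℝ) + s)
  have hZ := sq_nonneg (2 * (n 2 : ℝ) + s)
  have e2 : (5 / 4 * ρ) ^ 2 = 25 / 16 * ρ ^ 2 := by ring
  have e1 : (7 / 2 * ρ) ^ 2 = 49 / 4 * ρ ^ 2 := by ring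
  have e0 : (2 * ρ) ^ 2 = 4 * ρ ^ 2 := by ring
  have h2 := abs_le_of_sq_le_sq' (a := 2 * (n 2 : ℝ) + s) (b := 5 / 4 * ρ) (by linarith) (by linarith)
  have h1 := abs_le_of_sq_le_sq' (a := 3 * (n 1 : ℝ) + s) (b := 7 / 2 * ρ) (by linarith) (by linarith)
  have h0 :=
    abs_le_of_sq_le_sq' (a := 2 * (n 0 : ℝ) + n 1 + s) (b := 2 * ρ) (by linarith) (by linarith)
  obtain ⟨h2l, h2u⟩ := h2
  obtain ⟨h1l, h1u⟩ := h1
  obtain ⟨h0l, h0u⟩ := h0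
  obtain ⟨hsl, hsu⟩ := hs
  refine ⟨abs_le.mpr ⟨by linarith, by linarith⟩, abs_le.mpr ⟨by linarith, by linarith⟩,
    abs_le.mpr ⟨by linarith, by linarith⟩⟩

/-- **Path constant bound:** `pathConst c ≤ (13/2)‖ζ⁰_c‖²` when `‖ζ⁰_c‖ ≥ 100`
(`pathConst ≤ (4ρ + 3)((19/12)ρ + 5/3)`). [folklore] -/
theorem pathConst_le {c : BondClass} (hρ : 100 ≤ ‖bondVec 0 c‖) :
    pathConst c ≤ 13 / 2 * ‖bondVec 0 c‖ ^ 2 := by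
  obtain ⟨m, m', n⟩ := c
  obtain ⟨h2, h1, h0⟩ := abs_coord_le m m' n
  set ρ : ℝ := ‖bondVec 0 (m, m', n)‖
  have hρ0 : 0 ≤ ρ := norm_nonneg _
  have hL : 2 * |(n 2 : ℝ)| + |(n 0 : ℝ)| + |(n 1 : ℝ)| + 1 ≤ 4 * ρ + 3 := by linarith
  have hM : max (max |(n 0 : ℝ)| |(n 1 : ℝ)|) |(n 2 : ℝ)| + 1 ≤ 19 / 12 * ρ + 5 / 3 := by
    have := max_le (max_le h0 (h1.trans (by linarith))) (h2.trans (by linarith))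
    linarith
  have hM0 : 0 ≤ max (max |(n 0 : ℝ)| |(n 1 : ℝ)|) |(n 2 : ℝ)| + 1 := by positivity
  simp only [pathConst]
  push_cast
  calc (2 * |(n 2 : ℝ)| + |(n 0 : ℝ)| + |(n 1 : ℝ)| + 1) * (max (max |(n 0 : ℝ)| |(n 1 : ℝ)|) |(n 2 : ℝ)| + 1)
      ≤ (4 * ρ + 3) * (19 / 12 * ρ + 5 / 3) := mul_le_mul hL hM hM0 (by linarith)
    _ ≤ 13 / 2 * ρ ^ 2 := by nlinarith [mul_self_nonneg (ρ - 100)]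

/-- **Term bound:** a class outside `classesR R`, `R ≥ 100`, has `farCoeff c · pathConst c ≤ 117‖ζ⁰_c‖⁻⁶`
(`ρ = ‖ζ⁰_c‖ > R`, `18ρ⁻⁸ · (13/2)ρ² = 117ρ⁻⁶`). [folklore] -/
theorem farCoeff_mul_pathConst_le {R : ℝ} (hR : 100 ≤ R) {c : BondClass} (hc : c ∉ classesR R) :
    farCoeff c * pathConst c ≤ 117 * ‖bondVec 0 c‖⁻¹ ^ 6 := by
  have hlt : R < ‖bondVec 0 c‖ := TailStub.lt_norm_of_notMem hc
  have h100 : 100 ≤ ‖bondVec 0 c‖ := by linarith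
  have hpos : 0 < ‖bondVec 0 c‖ := by linarith
  have hP := pathConst_le h100
  unfold farCoeff
  calc 18 * ‖bondVec 0 c‖⁻¹ ^ 8 * pathConst c
      ≤ 18 * ‖bondVec 0 c‖⁻¹ ^ 8 * (13 / 2 * ‖bondVec 0 c‖ ^ 2) :=
        mul_le_mul_of_nonneg_left hP (by positivity)
    _ = 117 * ‖bondVec 0 c‖⁻¹ ^ 6 * (‖bondVec 0 c‖⁻¹ * ‖bondVec 0 c‖) ^ 2 := by ring
    _ = 117 * ‖bondVec 0 c‖⁻¹ ^ 6 := by rw [inv_mul_cancel₀ hpos.ne', one_pow, mul_one]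

/-! ## Dyadic shells -/

/-- Every real is below some `2^{k+1} R` (`R > 0`; the powers of `2` are unbounded). [folklore] -/
theorem exists_le_two_pow_mul {R : ℝ} (hR : 0 < R) (x : ℝ) : ∃ k : ℕ, x ≤ 2 ^ (k + 1) * R := by
  obtain ⟨k, hk⟩ := pow_unbounded_of_one_lt (x / R) (one_lt_two : (1 : ℝ) < 2)
  refine ⟨k, ?_⟩
  rw [div_lt_iff₀ hR] at hk
  have h2 : (2 : ℝ) ^ k * R ≤ 2 ^ (k + 1) * R := by
    rw [pow_succ 2 k]
    nlinarith [pow_pos (two_pos : (0 : ℝ) < 2) k]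
  linarith

/-- **The dyadic SHELL of `x` relative to `R > 0`:** the least `k` with `x ≤ 2^{k+1} R` also satisfies
`2^k R < x` as soon as `R < x` (minimality). [folklore] -/
theorem exists_shell {R : ℝ} (hR : 0 < R) (x : ℝ) :
    ∃ k : ℕ, x ≤ 2 ^ (k + 1) * R ∧ (R < x → 2 ^ k * R < x) := by
  refine ⟨Nat.find (exists_le_two_pow_mul hR x), Nat.find_spec (exists_le_two_pow_mul hR x), fun hx => ?_⟩
  cases hk : Nat.find (exists_le_two_pow_mul hR x) with
  | zero => rw [pow_zero, one_mul]; exact hx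
  | succ j =>
    have hmin : ¬ (x ≤ 2 ^ (j + 1) * R) :=
      Nat.find_min (exists_le_two_pow_mul hR x) (by rw [hk]; exact Nat.lt_succ_self j)
    exact not_le.mp hmin

/-- **Shell arithmetic** (with `P = 2^k`, `X = P·R ≥ 100`): `(4X + 1)³ · 117 X⁻⁶ ≤ 7600 · X⁻³`
(`4X + 1 ≤ 4.01X`, `4.01³ · 117 ≤ 7600`). [folklore] -/
theorem shell_arith_aux {P R : ℝ} (hP : 0 < P) (hR : 0 < R) (hX : 100 ≤ P * R) :
    (2 * (P * 2 * R) + 1) ^ 3 * (117 * (P * R)⁻¹ ^ 6) ≤ 7600 / R ^ 3 * P⁻¹ ^ 3 := by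
  have hX0 : 0 < P * R := by positivity
  have key : (4 * (P * R) + 1) ^ 3 * 117 ≤ 7600 * (P * R) ^ 3 := by
    have h1 : 4 * (P * R) + 1 ≤ 401 / 100 * (P * R) := by linarith
    have h2 : (4 * (P * R) + 1) ^ 3 ≤ (401 / 100 * (P * R)) ^ 3 :=
      pow_le_pow_left₀ (by positivity) h1 3
    nlinarith [h2, pow_nonneg hX0.le 3]
  have lhs : (2 * (P * 2 * R) + 1) ^ 3 * (117 * (P * R)⁻¹ ^ 6) =
      (4 * (P * R) + 1) ^ 3 * 117 / (P * R) ^ 6 := by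
    rw [inv_pow]
    ring
  have rhs : 7600 / R ^ 3 * P⁻¹ ^ 3 = 7600 * (P * R) ^ 3 / (P * R) ^ 6 := by
    field_simp
  rw [lhs, rhs]
  exact div_le_div_of_nonneg_right key (by positivity)

/-- **Shell arithmetic:** `(2^{k+2}R + 1)³ · 117(2^kR)⁻⁶ ≤ (7600/R³) · (1/8)^k` for `R ≥ 100`. [folklore] -/
theorem shell_arith {R : ℝ} (hR : 100 ≤ R) (k : ℕ) :
    (2 * (2 ^ (k + 1) * R) + 1) ^ 3 * (117 * (2 ^ k * R)⁻¹ ^ 6) ≤ 7600 / R ^ 3 * (1 / 8) ^ k := by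
  have hR0 : 0 < R := by linarith
  have hP : (1 : ℝ) ≤ 2 ^ k := one_le_pow₀ (by norm_num)
  have hX : 100 ≤ 2 ^ k * R := hR.trans (le_mul_of_one_le_left hR0.le hP)
  have h8 : (1 / 8 : ℝ) ^ k = ((2 : ℝ) ^ k)⁻¹ ^ 3 := by
    rw [← inv_pow, ← pow_mul, mul_comm, pow_mul]
    norm_num
  rw [h8, pow_succ (2 : ℝ) k]
  exact shell_arith_aux (by positivity) hR0 hX

/-! ## The partial sums -/

/-- The summand of `farTailConst R` is `≥ 0`. [folklore] -/
theorem tailTerm_nonneg (R : ℝ) (c : BondClass) :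
    0 ≤ (if c ∈ classesR R then (0 : ℝ) else farCoeff c * pathConst c) := by
  split_ifs
  · exact le_rfl
  · exact mul_nonneg (farCoeff_nonneg c) (pathConst_nonneg c)

/-- A class with `2^k R < ‖ζ⁰_c‖` (if outside `classesR R`) contributes `≤ 117(2^k R)⁻⁶` to the tail summand
(`R ≥ 100`; zero on `classesR R`, else the term bound and antitonicity of `t ↦ t⁻⁶`). [folklore] -/
theorem tailTerm_le {R : ℝ} (hR : 100 ≤ R) {c : BondClass} {k : ℕ}
    (hk : c ∉ classesR R → 2 ^ k * R < ‖bondVec 0 c‖) :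
    (if c ∈ classesR R then (0 : ℝ) else farCoeff c * pathConst c) ≤ 117 * (2 ^ k * R)⁻¹ ^ 6 := by
  have hR0 : 0 < R := by linarith
  split_ifs with hc
  · positivity
  · have h1 := farCoeff_mul_pathConst_le hR hc
    have h3 : ‖bondVec 0 c‖⁻¹ ≤ (2 ^ k * R)⁻¹ := inv_anti₀ (by positivity) (hk hc).le
    have h4 : ‖bondVec 0 c‖⁻¹ ^ 6 ≤ (2 ^ k * R)⁻¹ ^ 6 :=
      pow_le_pow_left₀ (inv_nonneg.mpr (norm_nonneg _)) h3 6
    linarith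

/-- **Shell count:** by `LatticeCount` on the shifted lattice `latVec ℤ³ + (σ(m') − σ(m))·innerRef`, a finite set of
classes of the pair `(m, m')` of reference length `≤ ρ` has at most `(2ρ + 1)³` elements. [folklore] -/
theorem card_le_of_norm_le (hL : LatticeCount) (m m' : Fin 2) {ρ : ℝ} (hρ : 0 ≤ ρ) (F : Finset (Fin 3 → ℤ))
    (hF : ∀ n ∈ F, ‖bondVec 0 (m, m', n)‖ ≤ ρ) : (F.card : ℝ) ≤ (2 * ρ + 1) ^ 3 := by
  refine hL ((subSign m' - subSign m) • innerRef) ρ hρ F fun n hn => ?_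
  rw [← WindowStub.bondVec_zero_eq]
  exact hF n hn

/-- **Per-pair bound:** for a sublattice pair `(m, m')`, `R ≥ 100` and a finite `S ⊆ ℤ³`, the tail summand sums to
`≤ 8700/R³` over the classes `(m, m', n)`, `n ∈ S` (fibrewise by the shell `2^k R < ‖ζ⁰‖ ≤ 2^{k+1}R`: count
`(2^{k+2}R + 1)³` × term bound `117(2^kR)⁻⁶` is `≤ 7600 · 8^{-k}/R³`, and `Σ_k 8^{-k} ≤ 8/7`). [folklore] -/
theorem pair_sum_le (hL : LatticeCount) {R : ℝ} (hR : 100 ≤ R) (m m' : Fin 2) (S : Finset (Fin 3 → ℤ)) :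
    ∑ n ∈ S, (if (m, m', n) ∈ classesR R then (0 : ℝ) else farCoeff (m, m', n) * pathConst (m, m', n)) ≤
      8700 / R ^ 3 := by
  have hR0 : 0 < R := by linarith
  -- the shell index of each class of the pair
  choose sh hsh using fun n : Fin 3 → ℤ => exists_shell hR0 ‖bondVec 0 (m, m', n)‖
  have hmaps : ∀ n ∈ S, sh n ∈ S.image sh := fun n hn => Finset.mem_image_of_mem _ hn
  rw [← Finset.sum_fiberwise_of_maps_to hmaps]
  have hfib : ∀ k ∈ S.image sh,
      ∑ n ∈ S with sh n = k,
          (if (m, m', n) ∈ classesR R then (0 : ℝ) else farCoeff (m, m', n) * pathConst (m, m', n)) ≤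
        7600 / R ^ 3 * (1 / 8) ^ k := by
    intro k _
    have hterm : ∀ n ∈ S.filter (fun n => sh n = k),
        (if (m, m', n) ∈ classesR R then (0 : ℝ) else farCoeff (m, m', n) * pathConst (m, m', n)) ≤
          117 * (2 ^ k * R)⁻¹ ^ 6 := fun n hn =>
      tailTerm_le hR fun hc => (Finset.mem_filter.mp hn).2 ▸ (hsh n).2 (TailStub.lt_norm_of_notMem hc)
    have hcard : ((S.filter fun n => sh n = k).card : ℝ) ≤ (2 * (2 ^ (k + 1) * R) + 1) ^ 3 :=
      card_le_of_norm_le hL m m' (by positivity) _ fun n hn =>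
        (Finset.mem_filter.mp hn).2 ▸ (hsh n).1
    calc ∑ n ∈ S with sh n = k,
          (if (m, m', n) ∈ classesR R then (0 : ℝ) else farCoeff (m, m', n) * pathConst (m, m', n))
        ≤ (S.filter fun n => sh n = k).card • (117 * (2 ^ k * R)⁻¹ ^ 6) :=
          Finset.sum_le_card_nsmul _ _ _ hterm
      _ = ((S.filter fun n => sh n = k).card : ℝ) * (117 * (2 ^ k * R)⁻¹ ^ 6) := nsmul_eq_mul _ _
      _ ≤ (2 * (2 ^ (k + 1) * R) + 1) ^ 3 * (117 * (2 ^ k * R)⁻¹ ^ 6) :=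
          mul_le_mul_of_nonneg_right hcard (by positivity)
      _ ≤ 7600 / R ^ 3 * (1 / 8) ^ k := shell_arith hR k
  have hgeo : Summable fun k : ℕ => (1 / 8 : ℝ) ^ k :=
    summable_geometric_of_lt_one (by norm_num) (by norm_num)
  calc ∑ k ∈ S.image sh, ∑ n ∈ S with sh n = k,
          (if (m, m', n) ∈ classesR R then (0 : ℝ) else farCoeff (m, m', n) * pathConst (m, m', n))
      ≤ ∑ k ∈ S.image sh, 7600 / R ^ 3 * (1 / 8 : ℝ) ^ k := Finset.sum_le_sum hfib
    _ = 7600 / R ^ 3 * ∑ k ∈ S.image sh, (1 / 8 : ℝ) ^ k := by rw [Finset.mul_sum]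
    _ ≤ 7600 / R ^ 3 * ∑' k, (1 / 8 : ℝ) ^ k :=
        mul_le_mul_of_nonneg_left (hgeo.sum_le_tsum _ fun k _ => by positivity) (by positivity)
    _ = 7600 / R ^ 3 * (8 / 7) := by
        rw [tsum_geometric_of_lt_one (by norm_num) (by norm_num)]
        norm_num
    _ ≤ 8700 / R ^ 3 := by
        rw [div_mul_eq_mul_div]
        exact div_le_div_of_nonneg_right (by norm_num) (by positivity)

/-- **Partial sums:** every finite partial sum of the tail summand is `≤ 40000/R³` (`R ≥ 100`): enlarge the finite
set to `univ × univ × S`, split by the four sublattice pairs, `4 · 8700 ≤ 40000`. [folklore] -/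
theorem sum_le (hL : LatticeCount) {R : ℝ} (hR : 100 ≤ R) (u : Finset BondClass) :
    ∑ c ∈ u, (if c ∈ classesR R then (0 : ℝ) else farCoeff c * pathConst c) ≤ 40000 / R ^ 3 := by
  have hR0 : 0 < R := by linarith
  have hsub : u ⊆ Finset.univ ×ˢ (Finset.univ ×ˢ u.image fun c => c.2.2) := by
    intro c hc
    simp only [Finset.mem_product, Finset.mem_univ, true_and]
    exact Finset.mem_image_of_mem (fun c : BondClass => c.2.2) hc
  calc ∑ c ∈ u, (if c ∈ classesR R then (0 : ℝ) else farCoeff c * pathConst c)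
      ≤ ∑ c ∈ Finset.univ ×ˢ (Finset.univ ×ˢ u.image fun c => c.2.2),
          (if c ∈ classesR R then (0 : ℝ) else farCoeff c * pathConst c) :=
        Finset.sum_le_sum_of_subset_of_nonneg hsub fun c _ _ => tailTerm_nonneg R c
    _ = ∑ m : Fin 2, ∑ m' : Fin 2, ∑ n ∈ u.image (fun c => c.2.2),
          (if (m, m', n) ∈ classesR R then (0 : ℝ) else farCoeff (m, m', n) * pathConst (m, m', n)) := by
        rw [Finset.sum_product]
        exact Finset.sum_congr rfl fun m _ => Finset.sum_product _ _ _
    _ ≤ ∑ _m : Fin 2, ∑ _m' : Fin 2, 8700 / R ^ 3 :=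
        Finset.sum_le_sum fun m _ => Finset.sum_le_sum fun m' _ => pair_sum_le hL hR m m' _
    _ = 34800 / R ^ 3 := by
        simp only [Finset.sum_const, Finset.card_univ, Fintype.card_fin, nsmul_eq_mul, Nat.cast_ofNat]
        ring
    _ ≤ 40000 / R ^ 3 := div_le_div_of_nonneg_right (by norm_num) (by positivity)

/-! ## The stub -/

/-- **S9 — TAIL SUM** (`stub_tailSum`): granted `LatticeCount`, for `R ≥ 100` the far-far lattice sum
`Σ_{‖ζ⁰_c‖ > R} 18‖ζ⁰_c‖⁻⁸ · pathConst c` converges and `farTailConst R ≤ 40000/R³` (nonnegative summand with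
uniformly bounded partial sums: `summable_of_sum_le`, `Real.tsum_le_of_sum_le`). [folklore] -/
theorem stub_tailSum : TailSum := by
  intro hL R hR
  have hnn : 0 ≤ fun c : BondClass => if c ∈ classesR R then (0 : ℝ) else farCoeff c * pathConst c :=
    fun c => tailTerm_nonneg R c
  have hbd : ∀ u : Finset BondClass,
      ∑ c ∈ u, (if c ∈ classesR R then (0 : ℝ) else farCoeff c * pathConst c) ≤ 40000 / R ^ 3 :=
    fun u => sum_le hL hR u
  exact ⟨summable_of_sum_le hnn hbd, Real.tsum_le_of_sum_le hnn hbd⟩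

end Summit.AtomisticToContinuum.Crystallization.Theorems.PhononStabilityCWC.TailSumStub

end
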